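/-
Copyright (c) 2026 the pub-hodgecm-mathlib formalisation cell (harness21).  Prover seat hodgecm-mathlib-LH4-p13 (g3), req620 Track A «(D-RAM) FOUR-FRAME» squad
(heir LEAD F0P3a-plan lineage; dealer LH4-plan (g11) WORD #52 (b) «κG₂ G₂∕G₃-κ BY ROTATION»; κ-road of unit U3_Laws, the (κ-B₂) child `stub_U3_kappaCount_typeTwo_mult` of
`Cruxes/H413/Lines/F0_P3c_DyRamFourFrame_U3_Laws.lean` ED. 10).  2026-09-04.
-/
import Summits.HodgeConjecture.HodgeConjecture.Theorems.F0P3cDyRamDiagonalKappaPermutation        -- ★ p856797 (this seat): `finsum_kappaCount_mul_stabiliserWeight_stratumTwo_G2_of_G1 ∕ _G3_of_G1` (slot-permuting adapters, type 2); brings ★ §P∕§P₂, ★ Fκ1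
import Summits.HodgeConjecture.HodgeConjecture.Theorems.F0P3cDyRamDiagonalKappaGluedSocketTwoZero -- ★ κG₂-C2₀ (F0P3-p01 (g31)): `finsum_kappaCount_two_mul_stabiliserWeight_hasAxis_G1_zero ∕ _G1_all` (root-glued ρ = 0, and the uniform head for every ρ ≥ 0)
import Summits.HodgeConjecture.HodgeConjecture.Theorems.F0P3cDyRamDiagonalKappaGluedRotations      -- ★ p856834 (this seat): `vec3_swap01 ∕ vec3_swap02` (slot vectors under the transpositions)
import HarnessLib

/-!
# Crux `H413`, «(D-RAM) FOUR-FRAME» road, unit U3_Laws, κ-STAGE B: «THE GLUED κ-SOCKETS WITH FOOT ON `B₂` AND `B₃`, TYPE 2 — ROOT-GLUED (ρ = 0) AND UNIFORM (ALL ρ ≥ 0)» by rotation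

Cell `hodgecm-mathlib` (D-0151), FLOOR 0, crux item H413 = `stmt-HodgeConjecture-24833`; lane `--supports stmt-HodgeConjecture-24833 --as helper` (count-neutral).  THEOREMS ONLY
(no `def`, no instance, no notation, no `sorry`).  Sequel of ★ `F0P3cDyRamDiagonalKappaGluedTwoRotations` (p856857, this seat: the ρ ≥ 1 rotations of ★ p856830).  F0P3-p01 (g31)'s
★ κG₂-C2₀ `F0P3cDyRamDiagonalKappaGluedSocketTwoZero` adds the ROOT-GLUED type-2 κ-socket `finsum_kappaCount_two_mul_stabiliserWeight_hasAxis_G1_zero` (axis `(1, 1+s, 1+s)` written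
`![2*0+1, 2*0+1+s, 2*0+1+s]`; TUBE₂ only — `ω(−1)·q^{s∕2}·((q−1)[2d ≤ s] − [s+2 = 2d])` in slot 0 iff `2∣s ∧ 1+s ≤ n₁`; no glue at ρ = 0) and the UNIFORM head
`finsum_kappaCount_two_mul_stabiliserWeight_hasAxis_G1_all` (every ρ ≥ 0, binders of the ρ ≥ 1 head minus `hρ`).  THIS FILE rotates both to the feet on `B₂` and `B₃` through this
seat's ★ κ-permutation adapters (p856797; `kappaCount σ ϖ 2 i (P·M) = kappaCount σ ϖ 2 (π i) M`), exactly as ★ p856857 did for ρ ≥ 1: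
* **`finsum_kappaCount_two_mul_stabiliserWeight_hasAxis_G2_zero ∕ _G3_zero`** — axes `(1+s, 1, 1+s)` ∕ `(1+s, 1+s, 1)` (same `2*0+1` tokens): TUBE₂ in slot 1 iff `2∣s ∧ 1+s ≤ n₂`,
  resp. in slot 2 iff `2∣s ∧ 1+s ≤ n₃`; binders `(hD) (h2) (hE) (hN₀) (hT) (s) (hs) (i)`.
* **`finsum_kappaCount_two_mul_stabiliserWeight_hasAxis_G2_all ∕ _G3_all`** — axes `(2ρ+1+s, 2ρ+1, 2ρ+1+s)` ∕ `(2ρ+1+s, 2ρ+1+s, 2ρ+1)`, every ρ ≥ 0: the statements of ★ p856857's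
  `_hasAxis_G2 ∕ _G3` WITHOUT `hρ` (datum `(β, α; n₂, n₁, n₃)`, slots `0 ↔ 1`, glue witness `|f₀ + (α−1)∕(β−1)| ≤ |ϖ|^{2ρ+1+s−n₁}`; resp. datum `(α⁻¹, βα⁻¹; n₃, n₂, n₁)`, slots `0 ↔ 2`,
  glue witness `|f₀ + (β−α)∕(1−α)| ≤ |ϖ|^{2ρ+1+s−n₂}`, `(βα⁻¹−1)∕(α⁻¹−1) = (β−α)∕(1−α)`).
So the (κ-B₂) assembler (LH4-p11 (g3)) has ONE uniform G-socket₂ per foot: `_G1_all` (g31) ∕ `_G2_all` ∕ `_G3_all` (here), binder-for-binder alike.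
HONEST LABEL.  Count-neutral (`--supports`); law-free transport; the κ-census laws (KMS children) stay PROVER TARGETS until the κ-assemblers close; `HC_CM` is proved only modulo
the 7 printed citations (2 remaining named inputs: hLiu418 = `stmt-HodgeConjecture-24832`, h413 = `stmt-HodgeConjecture-24833`) until rung 0 closes.

## References
* [Kottwitz1986BaseChangeUnits] R. E. Kottwitz, *Base change for unit elements of Hecke algebras*, Compositio Math. 60 (1986), §1 pp. 240–241 (κ-orbital integrals of units as signed
  fixed-lattice counts modulo the torus).
* [LanglandsShelstad1987] R. P. Langlands, D. Shelstad, *On the definition of transfer factors*, Math. Ann. 278 (1987), §3 (κ as a character).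
* [Rogawski1990] J. D. Rogawski, *Automorphic Representations of Unitary Groups in Three Variables*, Ann. of Math. Stud. 123 (1990), §4.9 Prop. 4.9.1 (a) p. 55.
-/

set_option autoImplicit false

noncomputable section

namespace Summit.HodgeConjecture.HodgeConjecture.Cruxes.H413.F0P3cDyRamDiagonalKappaGluedTwoRotationsAll

open Matrix
open Literature.NumberTheory.Automorphic Literature.NumberTheory.Automorphic.HermitianLattice
open Literature.NumberTheory.Automorphic.UnitaryLatticeTree Literature.NumberTheory.Automorphic.UnitaryThreeFourFrame
open Literature.NumberTheory.LocalFields.WildQuadraticDatum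
open Summit.HodgeConjecture.HodgeConjecture.Cruxes.H413.F0P3cDyRamDiagonalTorusDefs
open Summit.HodgeConjecture.HodgeConjecture.Cruxes.H413.F0P3cDyRamDiagonalStrataDefs
open Summit.HodgeConjecture.HodgeConjecture.Cruxes.H413.F0P3cDyRamDiagonalKappaCountDefs
open Summit.HodgeConjecture.HodgeConjecture.Cruxes.H413.F0P3cDyRamDiagonalKappaPermutation
open Summit.HodgeConjecture.HodgeConjecture.Cruxes.H413.F0P3cDyRamDiagonalKappaGluedRotations (vec3_swap01 vec3_swap02)
open Summit.HodgeConjecture.HodgeConjecture.Cruxes.H413.F0P3cDyRamDiagonalKappaGluedSocketTwoZero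
  (finsum_kappaCount_two_mul_stabiliserWeight_hasAxis_G1_zero finsum_kappaCount_two_mul_stabiliserWeight_hasAxis_G1_all)
open scoped Valued WithZero Matrix MatrixGroups

section Sockets

variable {K : Type} [Field K] [Valued K ℤᵐ⁰] [CompleteSpace K] [Fintype 𝓀[K]] {σ : K →+* K} {ϖ : K} {d t : ℕ} {α β : K} {N₀ n₁ n₂ n₃ : ℕ}
  {T : GL (Fin 3) K}

/-! ## §1  Root-glued (ρ = 0): feet on `B₂` and `B₃` -/

/-- **ROOT-GLUED κ-SOCKET₂, FOOT ON `B₂`** — axis `(1+s, 1, 1+s)` (`2*0+1` tokens), `s ≥ 1`, slot `i`: TUBE₂ `(0, ω(−1)·q^{s∕2}·((q−1)[2d ≤ s] − [s+2 = 2d]), 0)_i` iff `2∣s ∧ 1+s ≤ n₂`, else `0`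
(★ g31 `_hasAxis_G1_zero` at the swapped datum `(β, α; n₂, n₁, n₃)`, slots `0 ↔ 1`). [cite: Kottwitz1986BaseChangeUnits, §1 pp. 240–241] [cite: Rogawski1990, §4.9 Prop. 4.9.1 (a) p. 55] -/
theorem finsum_kappaCount_two_mul_stabiliserWeight_hasAxis_G2_zero (hD : IsRamifiedQuadraticDatum σ ϖ d t) (h2 : Valued.v (2 : K) < 1)
    (hE : IsElementDatum σ ϖ N₀ α β n₁ n₂ n₃) (hN₀ : d ≤ N₀) (hT : (T : Matrix (Fin 3) (Fin 3) K) = Matrix.diagonal ![α, β, 1])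
    (s : ℕ) (hs : 1 ≤ s) (i : Fin 3) :
    ∑ᶠ M ∈ stratumTwo σ ϖ T ![2 * 0 + 1 + s, 2 * 0 + 1, 2 * 0 + 1 + s], (kappaCount σ ϖ 2 i M : ℚ) * stabiliserWeight σ M =
      if 2 ∣ s ∧ 1 + s ≤ n₂ then
        (![0, (normSign σ (-1 : K) : ℚ) * (Fintype.card 𝓀[K] : ℚ) ^ (s / 2) *
            ((if 2 * d ≤ s then (Fintype.card 𝓀[K] : ℚ) - 1 else 0) - (if s + 2 = 2 * d then 1 else 0)), 0] : Fin 3 → ℚ) i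
      else 0 := by
  have key := finsum_kappaCount_mul_stabiliserWeight_stratumTwo_G2_of_G1 hE hT 2 (2 * 0 + 1) s (fun _ _ _ _ _ => True)
    (fun _ _ n₁' _ _ j =>
      if 2 ∣ s ∧ 1 + s ≤ n₁' then
        (![(normSign σ (-1 : K) : ℚ) * (Fintype.card 𝓀[K] : ℚ) ^ (s / 2) *
            ((if 2 * d ≤ s then (Fintype.card 𝓀[K] : ℚ) - 1 else 0) - (if s + 2 = 2 * d then 1 else 0)), 0, 0] : Fin 3 → ℚ) j
      else 0)
    (fun T' hE' hT' _ j => finsum_kappaCount_two_mul_stabiliserWeight_hasAxis_G1_zero hD h2 hE' hN₀ hT' s hs j) trivial i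
  rw [key]
  simp only [vec3_swap01]

/-- **ROOT-GLUED κ-SOCKET₂, FOOT ON `B₃`** — axis `(1+s, 1+s, 1)`, `s ≥ 1`, slot `i`: TUBE₂ `(0, 0, ω(−1)·q^{s∕2}·((q−1)[2d ≤ s] − [s+2 = 2d]))_i` iff `2∣s ∧ 1+s ≤ n₃`, else `0`
(★ g31 `_hasAxis_G1_zero` at the rescaled datum `(α⁻¹, βα⁻¹; n₃, n₂, n₁)`, slots `0 ↔ 2`). [cite: Kottwitz1986BaseChangeUnits, §1 pp. 240–241] [cite: Rogawski1990, §4.9 Prop. 4.9.1 (a) p. 55] -/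
theorem finsum_kappaCount_two_mul_stabiliserWeight_hasAxis_G3_zero (hD : IsRamifiedQuadraticDatum σ ϖ d t) (h2 : Valued.v (2 : K) < 1)
    (hE : IsElementDatum σ ϖ N₀ α β n₁ n₂ n₃) (hN₀ : d ≤ N₀) (hT : (T : Matrix (Fin 3) (Fin 3) K) = Matrix.diagonal ![α, β, 1])
    (s : ℕ) (hs : 1 ≤ s) (i : Fin 3) :
    ∑ᶠ M ∈ stratumTwo σ ϖ T ![2 * 0 + 1 + s, 2 * 0 + 1 + s, 2 * 0 + 1], (kappaCount σ ϖ 2 i M : ℚ) * stabiliserWeight σ M =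
      if 2 ∣ s ∧ 1 + s ≤ n₃ then
        (![0, 0, (normSign σ (-1 : K) : ℚ) * (Fintype.card 𝓀[K] : ℚ) ^ (s / 2) *
            ((if 2 * d ≤ s then (Fintype.card 𝓀[K] : ℚ) - 1 else 0) - (if s + 2 = 2 * d then 1 else 0))] : Fin 3 → ℚ) i
      else 0 := by
  have hvσ : ∀ a, Valued.v (σ a) = Valued.v a := hD.2.1
  have key := finsum_kappaCount_mul_stabiliserWeight_stratumTwo_G3_of_G1 hvσ hE hT 2 (2 * 0 + 1) s (fun _ _ _ _ _ => True)
    (fun _ _ n₁' _ _ j =>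
      if 2 ∣ s ∧ 1 + s ≤ n₁' then
        (![(normSign σ (-1 : K) : ℚ) * (Fintype.card 𝓀[K] : ℚ) ^ (s / 2) *
            ((if 2 * d ≤ s then (Fintype.card 𝓀[K] : ℚ) - 1 else 0) - (if s + 2 = 2 * d then 1 else 0)), 0, 0] : Fin 3 → ℚ) j
      else 0)
    (fun T' hE' hT' _ j => finsum_kappaCount_two_mul_stabiliserWeight_hasAxis_G1_zero hD h2 hE' hN₀ hT' s hs j) trivial i
  rw [key]
  simp only [vec3_swap02]

/-! ## §2  Uniform in ρ ≥ 0: feet on `B₂` and `B₃` -/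

/-- **κB-G₂ «GLUED-STRATA κ-SOCKET», FOOT ON `B₂`, TYPE 2, EVERY ρ ≥ 0** — axis `(2ρ+1+s, 2ρ+1, 2ρ+1+s)`, `s ≥ 1`, slot `i`, any fixed `f₀` which ON THE GLUE REGIME (`2∣s`, `n₁ = n₃`, `n₂ = n₁+s`,
`n₁ < 2ρ+1 ≤ 2n₁`, `2ρ+1−n₁ ≤ n₁−d+1`) approximates `−(α−1)∕(β−1)` to depth `2ρ+1+s−n₁`:  `Σᶠ κ²_i·w = [TUBE₂]_i + [GLUE₂]_i` with TUBE₂ (`2∣s`, `2ρ+1 ≤ min(n₁,n₃)`, `2ρ+1+s ≤ n₂`) =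
`(0, ω(−1)·q^{2ρ+s∕2}·((q−1)[2d ≤ s] − [s+2 = 2d]), 0)_i` and GLUE₂ = `([d ≤ ⌈(2ρ+1−n₁)∕2⌉]·ω(−1)ω(f₀)ω(1+f₀), [2d ≤ s + 2⌈(2ρ+1−n₁)∕2⌉]·ω(−1)ω(1+f₀), [d ≤ ⌈(2ρ+1−n₁)∕2⌉]·ω(f₀))_i ·
q^{2ρ+s∕2+1−⌈(2ρ+1−n₁)∕2⌉}` — F0P3-p01 (g31)'s ★ uniform head `_G1_all` at the swapped datum `(β, α; n₂, n₁, n₃)` through the ★ κ-permutation rule (slots `0 ↔ 1`).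
[cite: Kottwitz1986BaseChangeUnits, §1 pp. 240–241] [cite: LanglandsShelstad1987, §3] [cite: Rogawski1990, §4.9 Prop. 4.9.1 (a) p. 55] -/
theorem finsum_kappaCount_two_mul_stabiliserWeight_hasAxis_G2_all (hD : IsRamifiedQuadraticDatum σ ϖ d t) (h2 : Valued.v (2 : K) < 1)
    (hE : IsElementDatum σ ϖ N₀ α β n₁ n₂ n₃) (hN₀ : d ≤ N₀) (hT : (T : Matrix (Fin 3) (Fin 3) K) = Matrix.diagonal ![α, β, 1])
    (ρ s : ℕ) (hs : 1 ≤ s) (i : Fin 3) (f₀ : K) (hf₀ : σ f₀ = f₀)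
    (hglue : 2 ∣ s → n₁ = n₃ → n₂ = n₁ + s → n₁ < 2 * ρ + 1 → 2 * ρ + 1 ≤ 2 * n₁ → 2 * ρ + 1 - n₁ ≤ n₁ - d + 1 →
      Valued.v (f₀ + (α - 1) / (β - 1)) ≤ Valued.v ϖ ^ (2 * ρ + 1 + s - n₁)) :
    ∑ᶠ M ∈ stratumTwo σ ϖ T ![2 * ρ + 1 + s, 2 * ρ + 1, 2 * ρ + 1 + s], (kappaCount σ ϖ 2 i M : ℚ) * stabiliserWeight σ M =
      (if 2 ∣ s ∧ 2 * ρ + 1 ≤ min n₁ n₃ ∧ 2 * ρ + 1 + s ≤ n₂ then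
          (![0, (normSign σ (-1 : K) : ℚ) * (Fintype.card 𝓀[K] : ℚ) ^ (2 * ρ + s / 2) *
              ((if 2 * d ≤ s then (Fintype.card 𝓀[K] : ℚ) - 1 else 0) - (if s + 2 = 2 * d then 1 else 0)), 0] : Fin 3 → ℚ) i
        else 0) +
      (if 2 ∣ s ∧ n₁ = n₃ ∧ n₂ = n₁ + s ∧ n₁ < 2 * ρ + 1 ∧ 2 * ρ + 1 ≤ 2 * n₁ ∧ 2 * ρ + 1 - n₁ ≤ n₁ - d + 1 then
          (![if d ≤ (2 * ρ + 1 - n₁ + 1) / 2 then (normSign σ (-1 : K) : ℚ) * normSign σ f₀ * normSign σ (1 + f₀) else 0,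
             if 2 * d ≤ s + 2 * ((2 * ρ + 1 - n₁ + 1) / 2) then (normSign σ (-1 : K) : ℚ) * normSign σ (1 + f₀) else 0,
             if d ≤ (2 * ρ + 1 - n₁ + 1) / 2 then (normSign σ f₀ : ℚ) else 0] : Fin 3 → ℚ) i *
            (Fintype.card 𝓀[K] : ℚ) ^ (2 * ρ + s / 2 + 1 - (2 * ρ + 1 - n₁ + 1) / 2)
        else 0) := by
  -- the `B₁`-footed type-2 head as a slot vector `F` under the glue side condition `Hyp`, both over the element datum
  have key := finsum_kappaCount_mul_stabiliserWeight_stratumTwo_G2_of_G1 hE hT 2 (2 * ρ + 1) s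
    (fun α' β' n₁' n₂' n₃' => 2 ∣ s → n₂' = n₃' → n₁' = n₂' + s → n₂' < 2 * ρ + 1 → 2 * ρ + 1 ≤ 2 * n₂' → 2 * ρ + 1 - n₂' ≤ n₂' - d + 1 →
      Valued.v (f₀ + (β' - 1) / (α' - 1)) ≤ Valued.v ϖ ^ (2 * ρ + 1 + s - n₂'))
    (fun _ _ n₁' n₂' n₃' j =>
      (if 2 ∣ s ∧ 2 * ρ + 1 ≤ min n₂' n₃' ∧ 2 * ρ + 1 + s ≤ n₁' then
          (![(normSign σ (-1 : K) : ℚ) * (Fintype.card 𝓀[K] : ℚ) ^ (2 * ρ + s / 2) *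
              ((if 2 * d ≤ s then (Fintype.card 𝓀[K] : ℚ) - 1 else 0) - (if s + 2 = 2 * d then 1 else 0)), 0, 0] : Fin 3 → ℚ) j
        else 0) +
      (if 2 ∣ s ∧ n₂' = n₃' ∧ n₁' = n₂' + s ∧ n₂' < 2 * ρ + 1 ∧ 2 * ρ + 1 ≤ 2 * n₂' ∧ 2 * ρ + 1 - n₂' ≤ n₂' - d + 1 then
          (![if 2 * d ≤ s + 2 * ((2 * ρ + 1 - n₂' + 1) / 2) then (normSign σ (-1 : K) : ℚ) * normSign σ (1 + f₀) else 0,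
             if d ≤ (2 * ρ + 1 - n₂' + 1) / 2 then (normSign σ (-1 : K) : ℚ) * normSign σ f₀ * normSign σ (1 + f₀) else 0,
             if d ≤ (2 * ρ + 1 - n₂' + 1) / 2 then (normSign σ f₀ : ℚ) else 0] : Fin 3 → ℚ) j *
            (Fintype.card 𝓀[K] : ℚ) ^ (2 * ρ + s / 2 + 1 - (2 * ρ + 1 - n₂' + 1) / 2)
        else 0))
    (fun T' hE' hT' hHyp j => finsum_kappaCount_two_mul_stabiliserWeight_hasAxis_G1_all hD h2 hE' hN₀ hT' ρ s hs j f₀ hf₀ hHyp) hglue i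
  rw [key]
  simp only [vec3_swap01]

/-- **κB-G₂ «GLUED-STRATA κ-SOCKET», FOOT ON `B₃`, TYPE 2, EVERY ρ ≥ 0** — axis `(2ρ+1+s, 2ρ+1+s, 2ρ+1)`, `s ≥ 1`, slot `i`, any fixed `f₀` which ON THE GLUE REGIME (`2∣s`, `n₂ = n₁`, `n₃ = n₂+s`,
`n₂ < 2ρ+1 ≤ 2n₂`, `2ρ+1−n₂ ≤ n₂−d+1`) approximates `−(β−α)∕(1−α)` to depth `2ρ+1+s−n₂`:  `Σᶠ κ²_i·w = [TUBE₂]_i + [GLUE₂]_i` with TUBE₂ (`2∣s`, `2ρ+1 ≤ min(n₂,n₁)`, `2ρ+1+s ≤ n₃`) =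
`(0, 0, ω(−1)·q^{2ρ+s∕2}·((q−1)[2d ≤ s] − [s+2 = 2d]))_i` and GLUE₂ = `([d ≤ ⌈(2ρ+1−n₂)∕2⌉]·ω(f₀), [d ≤ ⌈(2ρ+1−n₂)∕2⌉]·ω(−1)ω(f₀)ω(1+f₀), [2d ≤ s + 2⌈(2ρ+1−n₂)∕2⌉]·ω(−1)ω(1+f₀))_i ·
q^{2ρ+s∕2+1−⌈(2ρ+1−n₂)∕2⌉}` — F0P3-p01 (g31)'s ★ uniform head `_G1_all` at the rescaled datum `(α⁻¹, βα⁻¹; n₃, n₂, n₁)` through the ★ κ-permutation rule (slots `0 ↔ 2`); `(βα⁻¹−1)∕(α⁻¹−1) = (β−α)∕(1−α)`.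
[cite: Kottwitz1986BaseChangeUnits, §1 pp. 240–241] [cite: LanglandsShelstad1987, §3] [cite: Rogawski1990, §4.9 Prop. 4.9.1 (a) p. 55] -/
theorem finsum_kappaCount_two_mul_stabiliserWeight_hasAxis_G3_all (hD : IsRamifiedQuadraticDatum σ ϖ d t) (h2 : Valued.v (2 : K) < 1)
    (hE : IsElementDatum σ ϖ N₀ α β n₁ n₂ n₃) (hN₀ : d ≤ N₀) (hT : (T : Matrix (Fin 3) (Fin 3) K) = Matrix.diagonal ![α, β, 1])
    (ρ s : ℕ) (hs : 1 ≤ s) (i : Fin 3) (f₀ : K) (hf₀ : σ f₀ = f₀)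
    (hglue : 2 ∣ s → n₂ = n₁ → n₃ = n₂ + s → n₂ < 2 * ρ + 1 → 2 * ρ + 1 ≤ 2 * n₂ → 2 * ρ + 1 - n₂ ≤ n₂ - d + 1 →
      Valued.v (f₀ + (β - α) / (1 - α)) ≤ Valued.v ϖ ^ (2 * ρ + 1 + s - n₂)) :
    ∑ᶠ M ∈ stratumTwo σ ϖ T ![2 * ρ + 1 + s, 2 * ρ + 1 + s, 2 * ρ + 1], (kappaCount σ ϖ 2 i M : ℚ) * stabiliserWeight σ M =
      (if 2 ∣ s ∧ 2 * ρ + 1 ≤ min n₂ n₁ ∧ 2 * ρ + 1 + s ≤ n₃ then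
          (![0, 0, (normSign σ (-1 : K) : ℚ) * (Fintype.card 𝓀[K] : ℚ) ^ (2 * ρ + s / 2) *
              ((if 2 * d ≤ s then (Fintype.card 𝓀[K] : ℚ) - 1 else 0) - (if s + 2 = 2 * d then 1 else 0))] : Fin 3 → ℚ) i
        else 0) +
      (if 2 ∣ s ∧ n₂ = n₁ ∧ n₃ = n₂ + s ∧ n₂ < 2 * ρ + 1 ∧ 2 * ρ + 1 ≤ 2 * n₂ ∧ 2 * ρ + 1 - n₂ ≤ n₂ - d + 1 then
          (![if d ≤ (2 * ρ + 1 - n₂ + 1) / 2 then (normSign σ f₀ : ℚ) else 0,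
             if d ≤ (2 * ρ + 1 - n₂ + 1) / 2 then (normSign σ (-1 : K) : ℚ) * normSign σ f₀ * normSign σ (1 + f₀) else 0,
             if 2 * d ≤ s + 2 * ((2 * ρ + 1 - n₂ + 1) / 2) then (normSign σ (-1 : K) : ℚ) * normSign σ (1 + f₀) else 0] : Fin 3 → ℚ) i *
            (Fintype.card 𝓀[K] : ℚ) ^ (2 * ρ + s / 2 + 1 - (2 * ρ + 1 - n₂ + 1) / 2)
        else 0) := by
  have hvσ : ∀ a, Valued.v (σ a) = Valued.v a := hD.2.1
  -- the glue unit of the rescaled datum: `(βα⁻¹ − 1)∕(α⁻¹ − 1) = (β − α)∕(1 − α)`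
  have hα : α * σ α = 1 := hE.1
  have hα0 : α ≠ 0 := fun h => by rw [h, zero_mul] at hα; exact zero_ne_one hα
  have hα1 : α ≠ 1 := hE.2.2.2.1
  have hfrac : (β * α⁻¹ - 1) / (α⁻¹ - 1) = (β - α) / (1 - α) := by
    have h1α : (1 : K) - α ≠ 0 := sub_ne_zero.2 (Ne.symm hα1)
    have hi : α⁻¹ - 1 = (1 - α) * α⁻¹ := by field_simp
    have hn : β * α⁻¹ - 1 = (β - α) * α⁻¹ := by field_simp
    rw [hi, hn, mul_div_mul_right _ _ (inv_ne_zero hα0)]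
  have key := finsum_kappaCount_mul_stabiliserWeight_stratumTwo_G3_of_G1 hvσ hE hT 2 (2 * ρ + 1) s
    (fun α' β' n₁' n₂' n₃' => 2 ∣ s → n₂' = n₃' → n₁' = n₂' + s → n₂' < 2 * ρ + 1 → 2 * ρ + 1 ≤ 2 * n₂' → 2 * ρ + 1 - n₂' ≤ n₂' - d + 1 →
      Valued.v (f₀ + (β' - 1) / (α' - 1)) ≤ Valued.v ϖ ^ (2 * ρ + 1 + s - n₂'))
    (fun _ _ n₁' n₂' n₃' j =>
      (if 2 ∣ s ∧ 2 * ρ + 1 ≤ min n₂' n₃' ∧ 2 * ρ + 1 + s ≤ n₁' then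
          (![(normSign σ (-1 : K) : ℚ) * (Fintype.card 𝓀[K] : ℚ) ^ (2 * ρ + s / 2) *
              ((if 2 * d ≤ s then (Fintype.card 𝓀[K] : ℚ) - 1 else 0) - (if s + 2 = 2 * d then 1 else 0)), 0, 0] : Fin 3 → ℚ) j
        else 0) +
      (if 2 ∣ s ∧ n₂' = n₃' ∧ n₁' = n₂' + s ∧ n₂' < 2 * ρ + 1 ∧ 2 * ρ + 1 ≤ 2 * n₂' ∧ 2 * ρ + 1 - n₂' ≤ n₂' - d + 1 then
          (![if 2 * d ≤ s + 2 * ((2 * ρ + 1 - n₂' + 1) / 2) then (normSign σ (-1 : K) : ℚ) * normSign σ (1 + f₀) else 0,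
             if d ≤ (2 * ρ + 1 - n₂' + 1) / 2 then (normSign σ (-1 : K) : ℚ) * normSign σ f₀ * normSign σ (1 + f₀) else 0,
             if d ≤ (2 * ρ + 1 - n₂' + 1) / 2 then (normSign σ f₀ : ℚ) else 0] : Fin 3 → ℚ) j *
            (Fintype.card 𝓀[K] : ℚ) ^ (2 * ρ + s / 2 + 1 - (2 * ρ + 1 - n₂' + 1) / 2)
        else 0))
    (fun T' hE' hT' hHyp j => finsum_kappaCount_two_mul_stabiliserWeight_hasAxis_G1_all hD h2 hE' hN₀ hT' ρ s hs j f₀ hf₀ hHyp)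
    (fun h1 h2' h3 h4 h5 h6 => by rw [hfrac]; exact hglue h1 h2' h3 h4 h5 h6) i
  rw [key]
  simp only [vec3_swap02]

end Sockets

end Summit.HodgeConjecture.HodgeConjecture.Cruxes.H413.F0P3cDyRamDiagonalKappaGluedTwoRotationsAll

end
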